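import Literature.NumberTheory.LFunctions.KMVExceptionalBranchPlateau

/-!
# K5-8 ★ PLATEAU LAW — the variational statement `KMV2000.PlateauLaw c₀` is a THEOREM (every `c₀ > 0`)

PROOF-KIND file (cell ls-idea, typer ls-idea-typ-1 gen 1): no new definition, no named fact. The
companion `KMVExceptionalBranchPlateau.lean` (p572877) typed card K5-8 ★ «(A)-PLATEAU LAW» (seat
ls-idea-lens-5 gen 3; critic A PASS ★ law at recipe grade): the exceptional-branch second table
`excSecondTable c₀ Δ P = Δ⁻¹ ∫₀^r P″(u)P″(r−u) du`, `r = plateauWindow c₀ Δ = 2(1 − c₀/Δ)`, and the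
card's PLATEAU LAW as the Prop `PlateauLaw c₀`. This file DISCHARGES it: `plateauLaw_holds :
0 < c₀ → PlateauLaw c₀`, together with the two elementary inequalities it rests on (Cauchy–Schwarz
against `1` on an interval for continuous functions; the weighted combination of two such bounds) and
the value-form corollary `valueWith … ≤ envelope c₀`. What this proves: a statement of real analysis
about a functional on polynomial profiles. What it does NOT prove: that this functional IS the
exceptional-branch main term (the card's recipe-level MODEL), nor anything about L-functions or
exceptional zeros. «The programme SEARCHES and TYPES; no claim about Landau–Siegel zeros, Theorems
1–2 of arXiv:2211.02515 or a repaired Margin232 until a kernel theorem says so.»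

## References
* [KowalskiMichelVanderKam2000] J. reine angew. Math. 526 (2000), Thm. 6.1 (31)–(32), §7 p. 21.
  [held: paper:doi-10-1515-crll-2000-074]
-/

noncomputable section

open Polynomial intervalIntegral MeasureTheory Set

namespace Literature.NumberTheory.LFunctions.KMV2000

/-- Cauchy–Schwarz against the constant `1` on `[a, b]` for a continuous function:
`(∫_a^b f)² ≤ (b − a) ∫_a^b f²` (from `0 ≤ ∫ (f − mean)²`). [folklore] -/
private theorem sq_integral_le_mul_integral_sq {a b : ℝ} (hab : a ≤ b) {f : ℝ → ℝ} (hf : Continuous f) :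
    (∫ x in a..b, f x) ^ 2 ≤ (b - a) * ∫ x in a..b, f x ^ 2 := by
  rcases eq_or_lt_of_le hab with heq | hlt
  · subst heq; simp
  have hba : 0 < b - a := sub_pos.2 hlt
  set I := ∫ x in a..b, f x with hI
  set m := I / (b - a) with hm
  have hmI : m * (b - a) = I := by rw [hm]; field_simp
  have h0 : 0 ≤ ∫ x in a..b, (f x - m) ^ 2 :=
    intervalIntegral.integral_nonneg hab (fun x _ => sq_nonneg _)
  have hfi : IntervalIntegrable f volume a b := hf.intervalIntegrable a b
  have hf2i : IntervalIntegrable (fun x => f x ^ 2) volume a b := (hf.pow 2).intervalIntegrable a b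
  have hcfi : IntervalIntegrable (fun x => 2 * m * f x) volume a b :=
    (continuous_const.mul hf).intervalIntegrable a b
  have hexp : ∫ x in a..b, (f x - m) ^ 2 =
      (∫ x in a..b, f x ^ 2) - 2 * m * I + m ^ 2 * (b - a) := by
    have e : (fun x => (f x - m) ^ 2) = fun x => (f x ^ 2 - 2 * m * f x) + m ^ 2 := by
      funext x; ring
    rw [e, intervalIntegral.integral_add (hf2i.sub hcfi) (by exact intervalIntegrable_const),
      intervalIntegral.integral_sub hf2i hcfi, intervalIntegral.integral_const_mul,
      intervalIntegral.integral_const, smul_eq_mul]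
    ring
  rw [hexp] at h0
  have := mul_nonneg hba.le h0
  nlinarith [hmI]

/-- Combining two weighted Cauchy–Schwarz bounds: `x² ≤ αX`, `y² ≤ βY` (all weights and masses
non-negative) give `(x + y)² ≤ (α + β)(X + Y)` (via `2xy ≤ αY + βX`). [folklore] -/
private theorem sq_add_le_of_sq_le {x y α β X Y : ℝ} (hα : 0 ≤ α) (hβ : 0 ≤ β) (hX : 0 ≤ X) (hY : 0 ≤ Y)
    (hx : x ^ 2 ≤ α * X) (hy : y ^ 2 ≤ β * Y) : (x + y) ^ 2 ≤ (α + β) * (X + Y) := by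
  have key : 2 * x * y ≤ α * Y + β * X := by
    have hprod : x ^ 2 * y ^ 2 ≤ (α * X) * (β * Y) := mul_le_mul hx hy (sq_nonneg _) (by positivity)
    have h1 : (2 * x * y) ^ 2 ≤ (α * Y + β * X) ^ 2 := by
      nlinarith [sq_nonneg (α * Y - β * X)]
    have hnn : 0 ≤ α * Y + β * X := by positivity
    by_cases hs : 2 * x * y ≤ 0
    · linarith
    · push Not at hs
      exact (pow_le_pow_iff_left₀ hs.le hnn two_ne_zero).1 h1
  nlinarith

/-- **K5-8 ★ PLATEAU LAW — PROVED.** For every `c₀ > 0`, every `Δ ∈ [c₀, 2c₀]` and every admissible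
profile `P` (`P(0) = P′(0) = 0`): `P′(1)² ≤ 2·envelope(c₀)·(secondMomentForm Δ P 1 + T₂^{(A)}(Δ,P;c₀))`,
i.e. on the card's exceptional branch the one-piece mollified value never exceeds the plateau
`envelope(c₀) = c₀/(2(1+c₀))`, INDEPENDENTLY of `Δ` («mollifying past `Y = D²` buys nothing»;
`Δ_eff = min(Δ, 1+2d)`). Proof (the card's, made rigorous for polynomial profiles): with `g = P″`,
`a = P′(1) = ∫₀¹ g`, window `r = 2(1 − c₀/Δ) ∈ (0,1]`, split `[0,1] = [0,r] ∪ [r,1]`, reflect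
`u ↦ r − u` on `[0,r]`: `∫₀^r g² + ∫₀^r g(u)g(r−u) = ½∫₀^r (g + g∘refl)²` and `∫₀^r (g + g∘refl) = 2∫₀^r g`;
Cauchy–Schwarz on the two pieces and the weighted combination give
`a² ≤ (1 − r/2)·(∫₀¹ g² + ∫₀^r g(u)g(r−u)) = (c₀/Δ)·(J + I)`, which is the claim after clearing
`2·envelope(c₀) = c₀/(1+c₀)`. At `Δ = c₀` the table vanishes and the bound is plain Cauchy–Schwarz.
The recipe-level INPUT (that `T₂^{(A)}` is the exceptional-branch table) is the card's MODEL and is not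
asserted; this theorem is pure real analysis about the functional `excSecondTable`.
[cite: KowalskiMichelVanderKam2000, Thm. 6.1 (32) and §7 p. 21 (the optimal profile)] -/
theorem plateauLaw_holds {c₀ : ℝ} (hc : 0 < c₀) : PlateauLaw c₀ := by
  intro Δ hΔlo hΔhi P hP
  have hΔ : 0 < Δ := lt_of_lt_of_le hc hΔlo
  have h1c : 0 < 1 + c₀ := by linarith
  -- the objects: `g = P″`, `a = P′(1) = ∫₀¹ g`, `J = ∫₀¹ g²`
  set g : ℝ → ℝ := fun u => (derivative (derivative P)).eval u with hgdef
  have hgc : Continuous g := Polynomial.continuous _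
  set a : ℝ := (derivative P).eval 1 with hadef
  have ha : ∫ x in (0 : ℝ)..1, g x = a := by
    have := integral_eq_sub_of_hasDerivAt (a := (0 : ℝ)) (b := 1)
      (fun x _ => Polynomial.hasDerivAt (derivative P) x) (hgc.intervalIntegrable 0 1)
    rw [hP.2, sub_zero] at this
    exact this
  set J : ℝ := ∫ x in (0 : ℝ)..1, g x ^ 2 with hJdef
  have hsecond : secondMomentForm Δ P 1 = a ^ 2 + Δ⁻¹ * J := by
    rw [secondMomentForm, linForm_one, offDiagForm_one]
    congr 2
    unfold unitIntegral
    exact intervalIntegral.integral_congr fun x _ => by simp [hgdef, eval_pow]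
  rw [linForm_one, hsecond]
  -- reduce to the key inequality `a² · Δ ≤ c₀ · (J + I)`
  have henv : 2 * envelope c₀ = c₀ / (1 + c₀) := by
    unfold envelope; field_simp
  rw [henv]
  rcases eq_or_lt_of_le hΔlo with heq | hlt
  · -- `Δ = c₀`: the table vanishes and the bound is Cauchy–Schwarz on `[0,1]`
    have htab : excSecondTable c₀ Δ P = 0 := by
      unfold excSecondTable plateauWindow
      rw [if_neg (by rw [← heq, div_self hc.ne']; norm_num)]
    rw [htab, add_zero]
    have hCS : a ^ 2 ≤ J := by
      have := sq_integral_le_mul_integral_sq zero_le_one hgc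
      rw [ha] at this
      simpa [hJdef] using this
    rw [div_mul_eq_mul_div, le_div_iff₀ h1c, ← heq]
    have hJ0 : 0 ≤ J := intervalIntegral.integral_nonneg zero_le_one (fun x _ => sq_nonneg _)
    have : a ^ 2 ≤ c₀ * (c₀⁻¹ * J) := by rw [← mul_assoc, mul_inv_cancel₀ hc.ne', one_mul]; exact hCS
    nlinarith
  · -- `c₀ < Δ ≤ 2c₀`: window `r = 2(1 − c₀/Δ) ∈ (0, 1]`
    set r : ℝ := plateauWindow c₀ Δ with hrdef
    have hr0 : 0 < r := by
      rw [hrdef, plateauWindow]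
      have : c₀ / Δ < 1 := by rw [div_lt_one hΔ]; exact hlt
      linarith
    have hr1 : r ≤ 1 := by
      rw [hrdef, plateauWindow]
      have : 1 / 2 ≤ c₀ / Δ := by
        rw [div_le_div_iff₀ (by norm_num) hΔ]; linarith
      linarith
    have hcr : 1 - r / 2 = c₀ / Δ := by rw [hrdef, plateauWindow]; ring
    set I : ℝ := ∫ u in (0 : ℝ)..r, g u * g (r - u) with hIdef
    have htab : excSecondTable c₀ Δ P = Δ⁻¹ * I := by
      unfold excSecondTable
      rw [if_pos hr0]
    rw [htab]
    -- pieces of `∫₀¹`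
    have hgr : Continuous fun u => g (r - u) := hgc.comp (continuous_const.sub continuous_id)
    set A₁ : ℝ := ∫ u in (0 : ℝ)..r, g u with hA₁
    set A₂ : ℝ := ∫ u in r..1, g u with hA₂
    set J₁ : ℝ := ∫ u in (0 : ℝ)..r, g u ^ 2 with hJ₁
    set J₂ : ℝ := ∫ u in r..1, g u ^ 2 with hJ₂
    have hA : a = A₁ + A₂ := by
      rw [← ha, hA₁, hA₂]
      exact (intervalIntegral.integral_add_adjacent_intervals (hgc.intervalIntegrable 0 r)
        (hgc.intervalIntegrable r 1)).symm
    have hJ : J = J₁ + J₂ := by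
      rw [hJdef, hJ₁, hJ₂]
      exact (intervalIntegral.integral_add_adjacent_intervals ((hgc.pow 2).intervalIntegrable 0 r)
        ((hgc.pow 2).intervalIntegrable r 1)).symm
    -- reflection `u ↦ r − u` on `[0, r]`
    have hreflA : ∫ u in (0 : ℝ)..r, g (r - u) = A₁ := by
      rw [hA₁, intervalIntegral.integral_comp_sub_left (fun u => g u) r]
      simp
    have hreflJ : ∫ u in (0 : ℝ)..r, g (r - u) ^ 2 = J₁ := by
      rw [hJ₁, intervalIntegral.integral_comp_sub_left (fun u => g u ^ 2) r]
      simp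
    -- the symmetrised square `∫₀^r (g(u) + g(r−u))² = 2 J₁ + 2 I`, its integral `= 2 A₁`
    have hHint : ∫ u in (0 : ℝ)..r, (g u + g (r - u)) = 2 * A₁ := by
      rw [intervalIntegral.integral_add (hgc.intervalIntegrable 0 r) (hgr.intervalIntegrable 0 r),
        hreflA, ← hA₁]
      ring
    have hHsq : ∫ u in (0 : ℝ)..r, (g u + g (r - u)) ^ 2 = 2 * J₁ + 2 * I := by
      have e : (fun u => (g u + g (r - u)) ^ 2) =
          fun u => (g u ^ 2 + 2 * (g u * g (r - u))) + g (r - u) ^ 2 := by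
        funext u; ring
      have i1 : IntervalIntegrable (fun u => g u ^ 2) volume 0 r := (hgc.pow 2).intervalIntegrable 0 r
      have i2 : IntervalIntegrable (fun u => 2 * (g u * g (r - u))) volume 0 r :=
        (continuous_const.mul (hgc.mul hgr)).intervalIntegrable 0 r
      have i3 : IntervalIntegrable (fun u => g (r - u) ^ 2) volume 0 r := (hgr.pow 2).intervalIntegrable 0 r
      rw [e, intervalIntegral.integral_add (i1.add i2) i3, intervalIntegral.integral_add i1 i2,
        intervalIntegral.integral_const_mul, hreflJ, ← hJ₁, ← hIdef]
      ring
    -- Cauchy–Schwarz on `[0, r]` for `g + g∘refl` and on `[r, 1]` for `g`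
    have hCS1 : (2 * A₁) ^ 2 ≤ r * (2 * J₁ + 2 * I) := by
      have := sq_integral_le_mul_integral_sq hr0.le (f := fun u => g u + g (r - u)) (hgc.add hgr)
      beta_reduce at this
      rw [hHint, hHsq, sub_zero] at this
      exact this
    have hCS2 : A₂ ^ 2 ≤ (1 - r) * J₂ := by
      have := sq_integral_le_mul_integral_sq hr1 hgc
      rw [← hA₂, ← hJ₂] at this
      exact this
    have hX0 : 0 ≤ J₁ + I := by
      have h0 : 0 ≤ ∫ u in (0 : ℝ)..r, (g u + g (r - u)) ^ 2 :=
        intervalIntegral.integral_nonneg hr0.le (fun u _ => sq_nonneg _)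
      rw [hHsq] at h0
      linarith
    have hY0 : 0 ≤ J₂ := intervalIntegral.integral_nonneg hr1 (fun u _ => sq_nonneg _)
    have hx : A₁ ^ 2 ≤ (r / 2) * (J₁ + I) := by nlinarith
    have hcomb := sq_add_le_of_sq_le (by linarith) (by linarith) hX0 hY0 hx hCS2
    -- `a² ≤ (1 − r/2)(J + I) = (c₀/Δ)(J + I)`
    have hkey : a ^ 2 ≤ c₀ / Δ * (J + I) := by
      rw [hA, hJ, ← hcr]
      calc (A₁ + A₂) ^ 2 ≤ (r / 2 + (1 - r)) * (J₁ + I + J₂) := hcomb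
        _ = (1 - r / 2) * (J₁ + J₂ + I) := by ring
    -- finish: `a² ≤ (c₀/(1+c₀))·(a² + Δ⁻¹ J + Δ⁻¹ I)`
    rw [div_mul_eq_mul_div, le_div_iff₀ h1c]
    have e2 : c₀ / Δ * (J + I) = c₀ * (Δ⁻¹ * J + Δ⁻¹ * I) := by
      rw [div_eq_mul_inv]; ring
    rw [e2] at hkey
    nlinarith

/-- **Value form of the plateau law (proved):** for `0 < c₀ ≤ Δ ≤ 2c₀` and admissible `P` with
positive total second main term, the exceptional-branch Cauchy–Schwarz value is at most the plateau:
`valueWith Δ P 1 0 (T₂^{(A)}) ≤ envelope c₀` (`= ¼ + d/(4(1+d))` at `c₀ = 1 + 2d`, below the force line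
`¼ + d/2` of the card's verdict (2)). [cite: KowalskiMichelVanderKam2000, Thm. 6.1 (31)–(32)] -/
theorem valueWith_excBranch_le_envelope {c₀ Δ : ℝ} (hc : 0 < c₀) (hlo : c₀ ≤ Δ) (hhi : Δ ≤ 2 * c₀)
    {P : ℝ[X]} (hP : Admissible P) (hpos : 0 < secondMomentForm Δ P 1 + excSecondTable c₀ Δ P) :
    valueWith Δ P 1 0 (excSecondTable c₀ Δ P) ≤ envelope c₀ := by
  have h := plateauLaw_holds hc Δ hlo hhi P hP
  rw [valueWith, add_zero, div_le_iff₀ (by positivity)]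
  linarith

end Literature.NumberTheory.LFunctions.KMV2000
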